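import Literature.AlgebraicTopology.SingularHomology.RelativeHomotopyInvariance
import Literature.AlgebraicTopology.SingularHomology.FundamentalClassProofs
import Literature.AlgebraicTopology.SingularHomology.LocalHomologyCharts
import Mathlib.Topology.Algebra.Group.Basic
import HarnessLib

/-!
# Topological groups which are topological manifolds are `ℤ`-orientable

A. Hatcher, *Algebraic Topology* (2002), §3.3, p. 234: an orientation of an `n`-manifold is a
locally consistent choice of generators `μₓ ∈ Hₙ(M | x; ℤ)`; for a topological GROUP one
translates a single generator around (J. M. Lee, *Introduction to Smooth Manifolds* (2013),
Prop. 15.19 / Example 15.18: left-invariant orientations — "every Lie group is orientable", and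
the tori `𝕋ⁿ` in particular).  The tree carried this construction out for the `3`-torus
(`Literature.Topology.FourManifolds.ThreeTorus.homologicalOrientation`, `ThreeTorusOrientation.lean`);
here it is done once and for all, for EVERY Hausdorff topological group `G : Type u` charted on
`𝔼ⁿ = EuclideanSpace ℝ (Fin n)`, with no smoothness:

* `mapsTo_mulLeft_compl`, `localHomology.map_mulLeft_comp`, `localHomology.map_mulLeft_one` —
  left translations as maps of pairs `(G, G ∖ x) → (G, G ∖ g x)` and their functoriality on local
  homology;
* `localHomology.map_mulLeft_eq_restrictToPoint_of_path` — **local consistency**: on a good ball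
  `B ∋ x` (`exists_isOpen_forall_isIso_restrictToPoint`) the class `μ_B` with `μ_B|ₓ = a`
  restricts at any `y` joined to `x` by a path `δ` in `B` to the translate `(y x⁻¹)_* a`:
  `F(t, z) = y (δ t)⁻¹ z` is a homotopy of maps of pairs `(G, G ∖ B) → (G, G ∖ y)` from the identity
  to the translation by `y x⁻¹` (homotopy invariance of relative homology, Hatcher Prop. 2.19,
  `relativeSingularHomology.map_eq_of_homotopic_holds`);
* **`isOrientableOver_int_of_isTopologicalGroup`** — `G` is `ℤ`-orientable in dimension `n`
  (`IsOrientableOver ℤ G n`): the translates `μₓ = x_* μ₁` of a generator `μ₁ ∈ Hₙ(G | 1; ℤ) ≅ ℤ`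
  (`nonempty_localHomology_iso_holds'`) form a homological `ℤ`-orientation.

In particular all tori `(S¹)ⁿ` (products of Mathlib's `Circle`, recharted on `𝔼ⁿ`) are
`ℤ`-orientable (`Literature.Topology.FourManifolds.FourTorusSignature`).  Everything is proved; no
definitions and no named facts are introduced (the orientation is produced inside the proof).

## References

* A. Hatcher, *Algebraic Topology*, CUP 2002, §2.1 Prop. 2.19; §3.3 pp. 231–236. [HatcherAT2002]
* J. M. Lee, *Introduction to Smooth Manifolds*, 2nd ed., GTM 218, Springer 2013, Prop. 15.19,
  Example 15.18. [LeeSmoothManifolds2013]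
-/

noncomputable section

open Set Function CategoryTheory
open scoped Topology unitInterval

universe u

namespace Literature.AlgebraicTopology.SingularHomology

variable {G : Type u} [TopologicalSpace G] [Group G] [IsTopologicalGroup G]

/-! ### Left translations on local homology -/

/-- Left translation by `g` sends `G ∖ {x}` into `G ∖ {y}` when `g x = y`: a map of pairs
`(G, G ∖ x) → (G, G ∖ y)`. [folklore] -/
theorem mapsTo_mulLeft_compl {g x y : G} (h : g * x = y) :
    MapsTo (Homeomorph.mulLeft g : C(G, G)) ({x}ᶜ : Set G) {y}ᶜ := by
  intro z hz hzy
  apply hz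
  have hzy : g * z = y := hzy
  rw [mem_singleton_iff]
  exact mul_left_cancel (hzy.trans h.symm)

/-- **Translations compose on local homology**: `(g' • ·)_* ∘ (g • ·)_* = (g' g • ·)_*` as maps
`Hₙ(G | x) → Hₙ(G | z)` (Hatcher 2002, §3.3: local homology is functorial in maps of pairs).
[folklore] -/
@[reassoc]
theorem localHomology.map_mulLeft_comp {g g' x y z : G} (h : g * x = y) (h' : g' * y = z)
    (n : ℕ) :
    relativeSingularHomology.map ℤ ℤ (Homeomorph.mulLeft g : C(G, G)) (mapsTo_mulLeft_compl h) n ≫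
      relativeSingularHomology.map ℤ ℤ (Homeomorph.mulLeft g' : C(G, G))
        (mapsTo_mulLeft_compl h') n =
      relativeSingularHomology.map ℤ ℤ (Homeomorph.mulLeft (g' * g) : C(G, G))
        (mapsTo_mulLeft_compl (show g' * g * x = z by rw [mul_assoc, h, h'])) n := by
  rw [← relativeSingularHomology.map_comp]
  exact relativeSingularHomology.map.congr_simp ℤ ℤ _ _
    (ContinuousMap.ext fun w => (mul_assoc g' g w).symm) _ n

/-- Translation by `1` is the identity on local homology. [folklore] -/
theorem localHomology.map_mulLeft_one (x : G) (h : (1 : G) * x = x) (n : ℕ) :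
    relativeSingularHomology.map ℤ ℤ (Homeomorph.mulLeft (1 : G) : C(G, G))
      (mapsTo_mulLeft_compl h) n = 𝟙 _ := by
  rw [← relativeSingularHomology.map_id]
  exact relativeSingularHomology.map.congr_simp ℤ ℤ _ _ (ContinuousMap.ext fun w => one_mul w) _ n

/-- Translation by `g` followed by translation by `g⁻¹` is the identity on `Hₙ(G | x)`.
[folklore] -/
theorem localHomology.map_mulLeft_comp_inv {g x y : G} (h : g * x = y) (n : ℕ) :
    relativeSingularHomology.map ℤ ℤ (Homeomorph.mulLeft g : C(G, G)) (mapsTo_mulLeft_compl h) n ≫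
      relativeSingularHomology.map ℤ ℤ (Homeomorph.mulLeft g⁻¹ : C(G, G))
        (mapsTo_mulLeft_compl (show g⁻¹ * y = x by rw [← h, inv_mul_cancel_left])) n = 𝟙 _ := by
  rw [localHomology.map_mulLeft_comp h (show g⁻¹ * y = x by rw [← h, inv_mul_cancel_left]),
    ← relativeSingularHomology.map_id]
  exact relativeSingularHomology.map.congr_simp ℤ ℤ _ _ (ContinuousMap.ext fun w => by simp) _ n

/-! ### Local consistency of translated classes, by homotopy invariance -/

/-- **Local consistency of translated local classes** (Hatcher 2002, §3.3, p. 234, the "local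
consistency condition", for classes translated around a topological group; Lee 2013,
Prop. 15.19). Let `B ∋ x` be a set for which `Hₙ(G | B) → Hₙ(G | x)` is an isomorphism, `a` a
class at `x`, `μ_B` THE class on `B` restricting to `a` at `x`, and `δ` a path from `y` to `x`
inside `B`. Then `μ_B|_y = (y x⁻¹)_* a`: the map `F(t, z) = y (δ t)⁻¹ z` is a homotopy of maps of
pairs `(G, G ∖ B) → (G, G ∖ y)` from the identity to the left translation by `y x⁻¹`, so both
induce the same map `Hₙ(G | B) → Hₙ(G | y)` (Hatcher Prop. 2.19,
`relativeSingularHomology.map_eq_of_homotopic_holds`), i.e.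
`restrict_y = restrict_x ≫ (y x⁻¹)_*`. [cite: HatcherAT2002, §3.3 p. 234] -/
theorem localHomology.map_mulLeft_eq_restrictToPoint_of_path {n : ℕ} {B : Set G} {x y : G}
    (hxB : x ∈ B) (hyB : y ∈ B) [IsIso (restrictToPoint ℤ ℤ hxB n)] (δ : Path y x)
    (hδ : ∀ t, δ t ∈ B) (a : localHomology ℤ ℤ G x n) :
    restrictToPoint ℤ ℤ hyB n (inv (restrictToPoint ℤ ℤ hxB n) a) =
      relativeSingularHomology.map ℤ ℤ (Homeomorph.mulLeft (y * x⁻¹) : C(G, G))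
        (mapsTo_mulLeft_compl (show y * x⁻¹ * x = y by rw [inv_mul_cancel_right])) n a := by
  set μB := inv (restrictToPoint ℤ ℤ hxB n) a with hμB
  have hμBx : restrictToPoint ℤ ℤ hxB n μB = a := by
    rw [hμB, ← ModuleCat.comp_apply, IsIso.inv_hom_id, ModuleCat.id_apply]
  -- the homotopy `F(t, z) = y (δ t)⁻¹ z` from `id` to the translation by `y x⁻¹`
  let F : ContinuousMap.Homotopy (ContinuousMap.id G) (Homeomorph.mulLeft (y * x⁻¹) : C(G, G)) :=
    { toFun := fun tz => y * (δ tz.1)⁻¹ * tz.2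
      continuous_toFun := by fun_prop
      map_zero_left := fun z => by simp
      map_one_left := fun z => by simp }
  have hF : ∀ tz : I × G, tz.2 ∈ (Bᶜ : Set G) → F tz ∈ ({y}ᶜ : Set G) := by
    rintro ⟨t, z⟩ hz hzy
    apply hz
    have hzy : y * (δ t)⁻¹ * z = y := hzy
    have : z = δ t := by
      have e := congrArg (fun w => δ t * (y⁻¹ * w)) hzy
      simpa [mul_assoc] using e
    rw [this]
    exact hδ t
  have h0 : MapsTo (ContinuousMap.id G) (Bᶜ : Set G) ({y}ᶜ : Set G) :=
    fun z hz hzy => hz (by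
      have hzy' : z = y := hzy
      exact hzy' ▸ hyB)
  have h1 : MapsTo (Homeomorph.mulLeft (y * x⁻¹) : C(G, G)) (Bᶜ : Set G) ({y}ᶜ : Set G) :=
    fun z hz hzy => by
      apply hz
      have hzy : y * x⁻¹ * z = y := hzy
      have : z = x := by
        have e := congrArg (fun w => x * (y⁻¹ * w)) hzy
        simpa [mul_assoc] using e
      rw [this]
      exact hxB
  have key := relativeSingularHomology.map_eq_of_homotopic_holds ℤ ℤ (X := G) (Y := G) h0 h1 F hF n
  -- `map id = restrictToPoint y`, `map (translation) = restrictToPoint x ≫ (y x⁻¹)_*`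
  have hL : relativeSingularHomology.map ℤ ℤ (ContinuousMap.id G) h0 n = restrictToPoint ℤ ℤ hyB n :=
    rfl
  have hR : relativeSingularHomology.map ℤ ℤ (Homeomorph.mulLeft (y * x⁻¹) : C(G, G)) h1 n =
      restrictToPoint ℤ ℤ hxB n ≫
        relativeSingularHomology.map ℤ ℤ (Homeomorph.mulLeft (y * x⁻¹) : C(G, G))
          (mapsTo_mulLeft_compl (show y * x⁻¹ * x = y by rw [inv_mul_cancel_right])) n := by
    rw [restrictToPoint, restrictLocal, ← relativeSingularHomology.map_comp]
    rfl
  rw [← hL, key, hR, ModuleCat.comp_apply, hμBx]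

/-! ### The orientation -/

/-- **A topological group which is a topological `n`-manifold is `ℤ`-orientable** (Hatcher 2002,
§3.3, p. 234: an orientation is a locally consistent choice of generators `μₓ ∈ Hₙ(M | x; ℤ)`;
Lee 2013, Prop. 15.19 / Example 15.18: translate one generator around the group — "every Lie
group is orientable", the tori `𝕋ⁿ` in particular). For a Hausdorff topological group `G`
charted on `𝔼ⁿ`: fix a generator `μ₁ ∈ Hₙ(G | 1; ℤ) ≅ ℤ` (`nonempty_localHomology_iso_holds'`) and
put `μₓ := x_* μ₁`; each `μₓ` is a generator (translation by `x⁻¹` is an inverse isomorphism), and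
the family is locally consistent: on a good ball `B ∋ x`
(`exists_isOpen_forall_isIso_restrictToPoint`) and a path-connected neighbourhood `W ⊆ B` of `x`
(charted spaces are locally path connected), the class `μ_B` with `μ_B|ₓ = μₓ` has
`μ_B|_y = (y x⁻¹)_* μₓ = μ_y` (`localHomology.map_mulLeft_eq_restrictToPoint_of_path`). No
smoothness is assumed. [cite: HatcherAT2002, §3.3 p. 234] [cite: LeeSmoothManifolds2013, Prop. 15.19 and Example 15.18] -/
theorem isOrientableOver_int_of_isTopologicalGroup {n : ℕ} (G : Type u) [TopologicalSpace G]
    [Group G] [IsTopologicalGroup G] [T2Space G] [ChartedSpace (EuclideanSpace ℝ (Fin n)) G] :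
    IsOrientableOver ℤ G n := by
  -- the reference generator `μ₁ ∈ Hₙ(G | 1; ℤ) ≅ ℤ`
  obtain ⟨i₁⟩ := nonempty_localHomology_iso_holds' ℤ G (n := n) (1 : G)
  let e₁ : localHomology ℤ ℤ G 1 n ≃ₗ[ℤ] ℤ := i₁.toLinearEquiv.trans ULift.moduleEquiv
  let μ₁ : localHomology ℤ ℤ G 1 n := e₁.symm 1
  have he₁ : e₁ μ₁ = 1 := e₁.apply_symm_apply 1
  -- translations `T g x y h : Hₙ(G | x) ⟶ Hₙ(G | y)` for `g x = y`
  let T : ∀ (g x y : G), g * x = y → (localHomology ℤ ℤ G x n ⟶ localHomology ℤ ℤ G y n) :=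
    fun g x y h => relativeSingularHomology.map ℤ ℤ (Homeomorph.mulLeft g : C(G, G))
      (mapsTo_mulLeft_compl h) n
  have T_comp : ∀ {g g' x y z : G} (h : g * x = y) (h' : g' * y = z),
      T g x y h ≫ T g' y z h' = T (g' * g) x z (by rw [mul_assoc, h, h']) :=
    fun h h' => localHomology.map_mulLeft_comp h h' n
  have T_one : ∀ (x : G) (h : (1 : G) * x = x), T 1 x x h = 𝟙 _ :=
    fun x h => localHomology.map_mulLeft_one x h n
  -- the local generators `μₓ = x_* μ₁`
  let gen : ∀ x : G, localHomology ℤ ℤ G x n := fun x => T x 1 x (mul_one x) μ₁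
  have T_gen : ∀ {g x y : G} (h : g * x = y), T g x y h (gen x) = gen y := by
    intro g x y h
    subst h
    change (T x 1 x (mul_one x) ≫ T g x (g * x) rfl) μ₁ = T (g * x) 1 (g * x) (mul_one _) μ₁
    rw [T_comp (mul_one x) rfl]
  have hgen : ∀ x : G, ∃ e : localHomology ℤ ℤ G x n ≃ₗ[ℤ] ℤ, e (gen x) = 1 := by
    intro x
    let Tiso : localHomology ℤ ℤ G x n ≅ localHomology ℤ ℤ G 1 n :=
      { hom := T x⁻¹ x 1 (inv_mul_cancel x)
        inv := T x 1 x (mul_one x)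
        hom_inv_id := by
          rw [T_comp (inv_mul_cancel x) (mul_one x), ← relativeSingularHomology.map_id]
          exact relativeSingularHomology.map.congr_simp ℤ ℤ _ _
            (ContinuousMap.ext fun w => by simp) _ n
        inv_hom_id := by
          rw [T_comp (mul_one x) (inv_mul_cancel x), ← relativeSingularHomology.map_id]
          exact relativeSingularHomology.map.congr_simp ℤ ℤ _ _
            (ContinuousMap.ext fun w => by simp) _ n }
    refine ⟨Tiso.toLinearEquiv.trans e₁, ?_⟩
    rw [LinearEquiv.trans_apply, Iso.toLinearEquiv_apply]
    change e₁ (T x⁻¹ x 1 (inv_mul_cancel x) (gen x)) = 1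
    rw [T_gen (inv_mul_cancel x)]
    change e₁ (T 1 1 1 (mul_one 1) μ₁) = 1
    rw [T_one 1 (mul_one 1), ModuleCat.id_apply, he₁]
  -- local consistency
  haveI : LocallyPathConnectedSpace G :=
    ChartedSpace.locallyPathConnectedSpace (EuclideanSpace ℝ (Fin n)) G
  refine ⟨{ localClass := gen, isGenerator := hgen, locallyConsistent := fun x => ?_ }⟩
  obtain ⟨B, hxB, hBo, -, hB⟩ :=
    exists_isOpen_forall_isIso_restrictToPoint ℤ ℤ (EuclideanSpace ℝ (Fin n)) x Filter.univ_mem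
  obtain ⟨W, ⟨hWn, hWpc⟩, hWB⟩ := (path_connected_basis x).mem_iff.mp (hBo.mem_nhds hxB)
  change W ⊆ B at hWB
  haveI := hB x hxB n
  refine ⟨W, hWn, restrictLocal ℤ ℤ hWB n (inv (restrictToPoint ℤ ℤ hxB n) (gen x)), fun y hy => ?_⟩
  rw [restrictToPoint_restrictLocal_apply]
  -- a path from `y` to `x` inside `W ⊆ B`
  have hxW : x ∈ W := mem_of_mem_nhds hWn
  let δ : Path y x := (hWpc.joinedIn y hy x hxW).somePath
  have hδ : ∀ t, δ t ∈ B := fun t => hWB ((hWpc.joinedIn y hy x hxW).somePath_mem t)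
  rw [localHomology.map_mulLeft_eq_restrictToPoint_of_path hxB (hWB hy) δ hδ (gen x)]
  exact T_gen (show y * x⁻¹ * x = y by rw [inv_mul_cancel_right])

end Literature.AlgebraicTopology.SingularHomology

end
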